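import Summits.MatrixMultiplication.OmegaCensus.DominoZ17StructSixArrA0
import HarnessLib

/-!
# The pair checks of family `A` for the structural part-`6` route, `p = 17` — RE-FILED per-`y`-chunk variant, part 2 of 2 (the accepted `DominoZ17StructSixPairsA1`, p439661, has no hub/farm olean: skipped build, OPS-REQUESTS 9n; these per-chunk decides have different statements and are assembled in `DominoZ17StructSixPairsA.lean` with `checkH6x_appendYS`)

ω-census `pub-omega`, family (b3), seat pub-omega-group gen 25.  Framing: lottery ticket; floor = certified bounds/negative
ranges.  VALUE: per-prime kernel data of the structural part-`6` route WITHOUT the pigeonhole (`DominoZpZpStructSixWide*.lean`)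
for `p = 17` — target: the OPEN census cell `(1,6,16)@289` (`A = ℤ₁₇²`) and every larger order with such a quotient; NOT progress on ω.

Per-`x`-arrangement kernel decides `checkH6x 17 etZ17s6 ysaZ17s6 xs` (one `x`-arrangement against the whole `y`-list of family `A`).
Assembly (`arr6T` literals, per-representative theorems, `checkH6a_17` = hypothesis `h3a` of `exists_goodS_wide`):
`DominoZ17StructSixPairsA.lean`.  Exact pre-check (`code/s6w_checkab.py`): every pinned configuration has ≥ 3 good collapses.
-/

namespace Summit.MatrixMultiplication.OmegaCensus

open ZpZpDomino

namespace ZpZpDomino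

set_option maxRecDepth 100000 in
set_option maxHeartbeats 4000000 in
/-- Pair check, family `A`, representative 1, `x`-arrangement 2, `y`-chunk 1 of 7. [folklore] -/
theorem checkH6axc_17_1_2_1 : checkH6x 17 etZ17s6 ysaZ17s6_1 [14,14,14,15,15,13] = true := by decide +kernel

set_option maxRecDepth 100000 in
set_option maxHeartbeats 4000000 in
/-- Pair check, family `A`, representative 1, `x`-arrangement 2, `y`-chunk 2 of 7. [folklore] -/
theorem checkH6axc_17_1_2_2 : checkH6x 17 etZ17s6 ysaZ17s6_2 [14,14,14,15,15,13] = true := by decide +kernel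

set_option maxRecDepth 100000 in
set_option maxHeartbeats 4000000 in
/-- Pair check, family `A`, representative 1, `x`-arrangement 2, `y`-chunk 3 of 7. [folklore] -/
theorem checkH6axc_17_1_2_3 : checkH6x 17 etZ17s6 ysaZ17s6_3 [14,14,14,15,15,13] = true := by decide +kernel

set_option maxRecDepth 100000 in
set_option maxHeartbeats 4000000 in
/-- Pair check, family `A`, representative 1, `x`-arrangement 2, `y`-chunk 4 of 7. [folklore] -/
theorem checkH6axc_17_1_2_4 : checkH6x 17 etZ17s6 ysaZ17s6_4 [14,14,14,15,15,13] = true := by decide +kernel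

set_option maxRecDepth 100000 in
set_option maxHeartbeats 4000000 in
/-- Pair check, family `A`, representative 1, `x`-arrangement 2, `y`-chunk 5 of 7. [folklore] -/
theorem checkH6axc_17_1_2_5 : checkH6x 17 etZ17s6 ysaZ17s6_5 [14,14,14,15,15,13] = true := by decide +kernel

set_option maxRecDepth 100000 in
set_option maxHeartbeats 4000000 in
/-- Pair check, family `A`, representative 1, `x`-arrangement 2, `y`-chunk 6 of 7. [folklore] -/
theorem checkH6axc_17_1_2_6 : checkH6x 17 etZ17s6 ysaZ17s6_6 [14,14,14,15,15,13] = true := by decide +kernel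

set_option maxRecDepth 100000 in
set_option maxHeartbeats 4000000 in
/-- Pair check, family `A`, representative 1, `x`-arrangement 2, `y`-chunk 7 of 7. [folklore] -/
theorem checkH6axc_17_1_2_7 : checkH6x 17 etZ17s6 ysaZ17s6_7 [14,14,14,15,15,13] = true := by decide +kernel

end ZpZpDomino

end Summit.MatrixMultiplication.OmegaCensus
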